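import Mathlib.Algebra.Group.Subgroup.Lattice
import Mathlib.Algebra.Group.Submonoid.Membership
import Mathlib.Algebra.Group.Pi.Lemmas
import Mathlib.Algebra.Group.Equiv.Basic
import Mathlib.Algebra.Group.PUnit
import HarnessLib

/-!
# L-LANA objects VII: the Θ-value-action construction / `η`-algorithm as a signature (LANA §6.2, §9.1)

Record-only file (D-0012) of the abc-iut cell (seat abc-iut-c312-4, L-LANA level, plan/LLANA-SPEC N14:
"Steps 2, 3, 4, 6 and the p. 36 containment = INTERFACE (this containment IS the part of Thm 3.11 the
argument uses); Steps 1, 5, 7, 8 DEFINE over the interfaces"); TAKES NO SIDE on [IUTchIII] Cor. 3.12.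
Project LANA's interim report (bib `LANA2026Report`, read on the page) describes the part of [IUTchIII]
Theorem 3.11 that "expresses the Θ-values as an action on log-shells" as a diagram (Fig. 3 p. 33 = Fig. 6
p. 44) of monoids, cohomology groups and maps, with Rem. 6.2.1 p. 33: "the following description is
necessarily schematic". This file types that diagram AT THE SAME SCHEMATIC LEVEL — every cohomology group
`∞H¹(…)` an abstract commutative group, every arrow an abstract homomorphism, each field quoting its
sentence — and DEFINES the composites the report defines:

* Steps 2–3 (§6.2 (c),(d) p. 34): "a distinguished subset `θ(Π_v) ⊆ H¹(Π_{v,Ÿ}, (l·Δ_Θ)(Π_v))` (6-1)";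
  "`∞θ(Π_v) ⊆ lim_J H¹(Π_{v,Ÿ}|_J, (l·Δ_Θ)(Π_v))`"; "`M^Θ_{v,∞} := O^×_v(Π_v) · ∞θ(Π_v)`" — fields `H1Y`,
  `thetaClasses`, `thetaInf`, `unitsEt`; DEFINED `thetaMonoidEt := unitsEt ⊔ thetaInf`.
* Step 4 (§6.2 (e) p. 35): "`Θ-Λ-rgd : Λ^{ext}_{Θ,v} ⥲ (l·Δ_Θ)(Π_v)` (6-2)", with the Frobenioid-theoretic
  theta monoid `M^{Θ,Frob}_{v,∞}` and its Kummer map (Fig. 3, left) — fields `MFrob`, `H1Yext`, `kum`,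
  `rgd` (the isomorphism induced on `∞H¹` by (6-2)).
* Step 5 (§6.2 (f) p. 35): "Restriction to these decomposition groups gives
  `∞H¹(Π_{v,Ÿ}, (l·Δ_Θ)(Π_v)) → ∏_t ∞H¹(D_t, (l·Δ_Θ)(Π_v))` (6-3)" — fields `T` (labels `t` of the points
  `x_t`, Fig. 1 p. 15), `H1D`, `res`; DEFINED `psi` = "the map (say, `ψ_v`) from (the Frobenius-like version
  of) the theta monoid `M^Θ_{v,∞}` to the product of `∞H¹(D_t, (l·Δ_Θ)(Π_v))`" (p. 36) `= (6-3) ∘ rgd ∘ kum`.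
* Step 6 (§6.2 (g) p. 35): "`ι_t : C_v ⥲ Λ_{v,t}`" (cyclotomic synchronization), "`κ_t : O^▷_{v,t} →
  ∞H¹(D_t, Λ_{v,t})` is the local Kummer map", "`φ_{v,t} = (ι_t)_*⁻¹ ∘ κ_t`" — fields `O`, `H1DΛ`, `kappa`,
  `sync`; DEFINED `phi t`, `phiProd = ∏_t φ_{v,t}`.
* THE CONTAINMENT (p. 36): "An important part of the content of Theorem 3.11 (see also [IUTchIII]
  Prop. 3.5 (ii)) is that the image of the map (say, `ψ_v`) … is contained in the image of
  `φ_v := ∏_t φ_{v,t}`" — `EtaSteps.Containment` (HYPOTHESIS: a `Prop`, [IUTchIII] Thm. 3.11 (ii));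
  §9.1 (f) p. 45 prints it as "one proves that the map from `M_∞` described above actually factors through
  this `∏_t O^▷_{v,t}`" — `EtaSteps.Factors`; PROVED: `Factors → Containment` and, when the local Kummer maps
  are injective, `Containment → Factors` with a UNIQUE factorisation (`factorisation`,
  `factorisation_unique`) — the two printed forms agree at this level.
* Step 7 (§6.2 (h) p. 36): "the discrete `ℕ`-part of the Gaussian monoid may naturally be regarded as a
  submonoid of `∏_t O^▷_{v,t}`" (Rem. 6.2.3: the Gaussian monoid "comes with a splitting roughly like
  `((q^{t²}_v)_t)^ℕ · O^×_{v,0}`") — field `qPow = (q_v^{t²})_t`, DEFINED `thetaValuesN` (the `ℕ`-part);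
  the ACTION (6-4) "`LGP^ℕ_v ↷ ∏_t I_{v,t}`" and Step 8's regions `LGP·U ⊆ VC(I) ⊗ ℚ` need the additive
  structure of log-shells/containers (LLANA-SPEC N10/N11) and are typed in `LanaRss.lean` as the datum
  `EtaData.LGP` — not here.

Modelling notes. (i) No topology, no profiniteness, no actual cohomology: the report's own level
(Rem. 6.2.1). The real objects come from: tempered `Π_v`, `Π_{v,Ÿ}`, `Δ_Θ` (seat abc-iut-L3-t2); étale theta
class and mono-theta cyclotomic rigidity [EtTh] (abc-iut-L2-t1/t2/t4); Kummer maps into `H¹` (abc-iut-L2-t3,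
`Literature/AnabelianGeometry/EtaleTheta/Cyclotome.lean` landed); Gaussian monoids [IUTchII] (abc-iut-L6-t1);
[IUTchIII] Thm. 3.11 (ii) itself (abc-iut-c312-1, `Thm311Sig.lean`). Each field below is a TODO-merge slot.
(ii) Step 1 (choice of realisation; (Ind1), (Ind2)) is `LanaThetaLink.Realisation`; Step 9 ((Ind3), upper
semi-compatibility) is the datum `EtaData.Suitable` of `LanaRss.lean`. NOT here: any judgement.
-/

namespace Summit.ABC
namespace IUTFork

/-! ## 1. The signature of Fig. 3 / Fig. 6 at one place `v` -/

/-- **The `η`-algorithm diagram at a place `v` (Fig. 3 p. 33 = Fig. 6 p. 44), as a signature.** Every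
cohomology group is an abstract commutative group and every arrow an abstract homomorphism (Rem. 6.2.1:
"necessarily schematic"); see the module docstring for the sentence each field quotes and the seat whose
construction replaces it. [cite: LANA2026Report, §6.2 pp. 33–36, §9.1 pp. 44–45] -/
structure EtaSteps : Type 1 where
  /-- `∞H¹(Π_{v,Ÿ}, (l·Δ_Θ)(Π_v))` (interior coefficients), Steps 2–3 -/
  H1Y : Type
  [instH1Y : CommGroup H1Y]
  /-- `θ(Π_v)`, "the functorially reconstructed set of `μ_l`-multiples of the reciprocal of the
  "`(l·ℤ×μ₂)`-orbit of an `l`-th root of the étale theta function of standard type"" (6-1) -/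
  thetaClasses : Set H1Y
  /-- `∞θ(Π_v)`, the direct-limit theta classes (§6.2 (d)) -/
  thetaInf : Submonoid H1Y
  /-- `O^×_v(Π_v)`, "an étale-like copy of `O^×_v` reconstructed from `Π_v`" (§6.2 (d)) -/
  unitsEt : Submonoid H1Y
  /-- `θ(Π_v) ⊆ ∞θ(Π_v)` (an element of `θ` is its own "positive multiple") -/
  thetaClasses_subset : thetaClasses ⊆ thetaInf
  /-- `M^{Θ,Frob}_{v,∞}`, the Frobenioid-theoretic theta monoid (Fig. 3, left; Step 4) -/
  MFrob : Type
  [instMFrob : CommMonoid MFrob]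
  /-- `∞H¹(Π_{v,Ÿ}, Λ(M^{Θ,Frob}_{v,∞})) = ∞H¹(Π_{v,Ÿ}, Λ^{ext}_{Θ,v})` (exterior coefficients) -/
  H1Yext : Type
  [instH1Yext : CommGroup H1Yext]
  /-- the Kummer map of the theta monoid ("Kummer", Fig. 3) -/
  kum : MFrob →* H1Yext
  /-- the isomorphism on `∞H¹` induced by `Θ-Λ-rgd : Λ^{ext}_{Θ,v} ⥲ (l·Δ_Θ)(Π_v)` (6-2) -/
  rgd : H1Yext ≃* H1Y
  /-- the labels `t` (points `x_t` of Fig. 1 p. 15; decomposition groups `D_t`, Step 5) -/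
  T : Type
  /-- `∞H¹(D_t, (l·Δ_Θ)(Π_v))` -/
  H1D : T → Type
  [instH1D : ∀ t, CommGroup (H1D t)]
  /-- restriction to `D_t`, the components of (6-3) ("Galois evaluation") -/
  res : ∀ t, H1Y →* H1D t
  /-- `O^▷_{v,t}` ("the local monoid belonging to a certain prime-strip `Ψ_cns(F_≻)_t`", Rem. 6.2.3) -/
  O : T → Type
  [instO : ∀ t, CommMonoid (O t)]
  /-- `∞H¹(D_t, Λ_{v,t})`, `Λ_{v,t} := Λ(K̄_{v,t})` -/
  H1DΛ : T → Type
  [instH1DΛ : ∀ t, CommGroup (H1DΛ t)]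
  /-- the local Kummer maps `κ_t : O^▷_{v,t} → ∞H¹(D_t, Λ_{v,t})` -/
  kappa : ∀ t, O t →* H1DΛ t
  /-- cyclotomic synchronization `(ι_t)_* : ∞H¹(D_t, C_v) ⥲ ∞H¹(D_t, Λ_{v,t})`, `ι_t : C_v ⥲ Λ_{v,t}` -/
  sync : ∀ t, H1D t ≃* H1DΛ t
  /-- the theta values `(q_v^{t²})_t ∈ ∏_t O^▷_{v,t}` (Rem. 6.2.3 "splitting … `((q^{t²}_v)_t)^ℕ · O^×_{v,0}`") -/
  qPow : ∀ t, O t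

attribute [instance] EtaSteps.instH1Y EtaSteps.instMFrob EtaSteps.instH1Yext EtaSteps.instH1D
  EtaSteps.instO EtaSteps.instH1DΛ

namespace EtaSteps

variable (A : EtaSteps)

/-! ## 2. The composites the report defines (Steps 3, 5, 6, 7) -/

/-- **Step 3**: "`M^Θ_{v,∞} := O^×_v(Π_v) · ∞θ(Π_v)`" — the étale-like (Kummer-image) theta monoid, the
submonoid generated by the two. [cite: LANA2026Report, §6.2 (d) p. 34] -/
def thetaMonoidEt : Submonoid A.H1Y := A.unitsEt ⊔ A.thetaInf

/-- `∞θ(Π_v) ⊆ M^Θ_{v,∞}`. [cite: LANA2026Report, §6.2 (d) p. 34] -/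
theorem thetaInf_le_thetaMonoidEt : A.thetaInf ≤ A.thetaMonoidEt := le_sup_right

/-- `θ(Π_v) ⊆ M^Θ_{v,∞}`. [cite: LANA2026Report, §6.2 (c),(d) p. 34] -/
theorem thetaClasses_subset_thetaMonoidEt : A.thetaClasses ⊆ A.thetaMonoidEt :=
  A.thetaClasses_subset.trans A.thetaInf_le_thetaMonoidEt

/-- **Step 5, `ψ_v`** (p. 36: "the map (say, `ψ_v`) from (the Frobenius-like version of) the theta monoid
`M^Θ_{v,∞}` to the product of `∞H¹(D_t, (l·Δ_Θ)(Π_v))`"): Kummer map, then `Θ-Λ-rgd` (6-2), then the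
restrictions (6-3). [cite: LANA2026Report, §6.2 (f) p. 35, p. 36] -/
def psi : A.MFrob →* ∀ t, A.H1D t :=
  (MonoidHom.pi A.res).comp (A.rgd.toMonoidHom.comp A.kum)

/-- `ψ_v` componentwise. [cite: LANA2026Report, §6.2 (f) p. 35] -/
@[simp] theorem psi_apply (m : A.MFrob) (t : A.T) : A.psi m t = A.res t (A.rgd (A.kum m)) := rfl

/-- **Step 6, `φ_{v,t} = (ι_t)_*⁻¹ ∘ κ_t : O^▷_{v,t} → ∞H¹(D_t, (l·Δ_Θ)(Π_v))`**.
[cite: LANA2026Report, §6.2 (g) p. 35] -/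
def phi (t : A.T) : A.O t →* A.H1D t := (A.sync t).symm.toMonoidHom.comp (A.kappa t)

/-- `φ_{v,t}` evaluated. [cite: LANA2026Report, §6.2 (g) p. 35] -/
@[simp] theorem phi_apply (t : A.T) (a : A.O t) : A.phi t a = (A.sync t).symm (A.kappa t a) := rfl

/-- `φ_v := ∏_t φ_{v,t} : ∏_t O^▷_{v,t} → ∏_t ∞H¹(D_t, (l·Δ_Θ)(Π_v))`. [cite: LANA2026Report, §6.2 (g) p. 36] -/
def phiProd : (∀ t, A.O t) →* ∀ t, A.H1D t :=
  MonoidHom.pi fun t => (A.phi t).comp (Pi.evalMonoidHom A.O t)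

/-- `φ_v` componentwise. [cite: LANA2026Report, §6.2 (g) p. 36] -/
@[simp] theorem phiProd_apply (a : ∀ t, A.O t) (t : A.T) : A.phiProd a t = A.phi t (a t) := rfl

/-- `φ_v` is injective as soon as every local Kummer map `κ_t` is (the `(ι_t)_*` are isomorphisms).
[cite: LANA2026Report, §6.2 (g) p. 35] -/
theorem phiProd_injective (hκ : ∀ t, Function.Injective (A.kappa t)) : Function.Injective A.phiProd := by
  intro a b h
  funext t
  have ht := congrFun h t
  rw [phiProd_apply, phiProd_apply, phi_apply, phi_apply] at ht
  exact hκ t ((A.sync t).symm.injective ht)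

/-- **Step 7, the discrete `ℕ`-part `((q_v^{t²})_t)^ℕ`** of the Gaussian monoid inside `∏_t O^▷_{v,t}`
(Rem. 6.2.3). [cite: LANA2026Report, §6.2 (h) p. 36, Rem. 6.2.3 p. 36] -/
def thetaValuesN : Submonoid (∀ t, A.O t) := Submonoid.powers A.qPow

/-- `(q_v^{t²})_t` generates the `ℕ`-part. [cite: LANA2026Report, Rem. 6.2.3 p. 36] -/
theorem qPow_mem_thetaValuesN : A.qPow ∈ A.thetaValuesN := Submonoid.mem_powers _

/-! ## 3. The containment = "the part of Theorem 3.11 the argument uses" -/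

/-- **THE CONTAINMENT (HYPOTHESIS; [IUTchIII] Thm. 3.11 (ii), Prop. 3.5 (ii) as read by LANA p. 36)**:
"the image of the map (say, `ψ_v`) from (the Frobenius-like version of) the theta monoid `M^Θ_{v,∞}` to the
product of `∞H¹(D_t, (l·Δ_Θ)(Π_v))` is contained in the image of `φ_v := ∏_t φ_{v,t}`".
[cite: LANA2026Report, §6.2 (g) p. 36] -/
@[cite "LANA2026Report" "§6.2 (g) p. 36"]
def Containment : Prop := Set.range A.psi ⊆ Set.range A.phiProd

/-- **The same, as printed in §9.1 (f) p. 45 (HYPOTHESIS)**: "one proves that the map from `M_∞` described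
above actually factors through this `∏_t O^▷_{v,t}`" — existence of a factorisation `λ` with
`φ_v ∘ λ = ψ_v`. [cite: LANA2026Report, §9.1 (f) p. 45] -/
@[cite "LANA2026Report" "§9.1 (f) p. 45"]
def Factors : Prop := ∃ lam : A.MFrob →* ∀ t, A.O t, A.phiProd.comp lam = A.psi

/-- A factorisation gives the containment. [cite: LANA2026Report, §9.1 (f) p. 45] -/
theorem containment_of_factors (h : A.Factors) : A.Containment := by
  obtain ⟨lam, hlam⟩ := h
  rintro _ ⟨m, rfl⟩
  exact ⟨lam m, by rw [← hlam]; rfl⟩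

/-- Conversely, with injective local Kummer maps the containment yields a factorisation — constructed:
`λ(m) :=` the unique preimage of `ψ_v(m)` under `φ_v`. [cite: LANA2026Report, §9.1 (f) p. 45] -/
noncomputable def factorisation (hκ : ∀ t, Function.Injective (A.kappa t)) (h : A.Containment) :
    A.MFrob →* ∀ t, A.O t where
  toFun m := Classical.choose (h ⟨m, rfl⟩)
  map_one' := by
    apply A.phiProd_injective hκ
    have h1 : A.phiProd (Classical.choose (h ⟨1, rfl⟩)) = A.psi 1 := Classical.choose_spec (h ⟨1, rfl⟩)
    rw [h1, map_one, map_one]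
  map_mul' m m' := by
    apply A.phiProd_injective hκ
    have h1 : A.phiProd (Classical.choose (h ⟨m * m', rfl⟩)) = A.psi (m * m') :=
      Classical.choose_spec (h ⟨m * m', rfl⟩)
    have h2 : A.phiProd (Classical.choose (h ⟨m, rfl⟩)) = A.psi m := Classical.choose_spec (h ⟨m, rfl⟩)
    have h3 : A.phiProd (Classical.choose (h ⟨m', rfl⟩)) = A.psi m' :=
      Classical.choose_spec (h ⟨m', rfl⟩)
    rw [map_mul A.phiProd, h1, h2, h3, map_mul]

/-- The constructed factorisation factors `ψ_v` through `φ_v`. [cite: LANA2026Report, §9.1 (f) p. 45] -/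
theorem phiProd_comp_factorisation (hκ : ∀ t, Function.Injective (A.kappa t)) (h : A.Containment) :
    A.phiProd.comp (A.factorisation hκ h) = A.psi :=
  MonoidHom.ext fun m =>
    (Classical.choose_spec (h ⟨m, rfl⟩) : A.phiProd (Classical.choose (h ⟨m, rfl⟩)) = A.psi m)

/-- **Containment ⟺ factorisation** (injective Kummer maps): the p. 36 and p. 45 forms of "the part of
Theorem 3.11 the argument uses" agree at this level. [cite: LANA2026Report, §6.2 (g) p. 36, §9.1 (f) p. 45] -/
theorem containment_iff_factors (hκ : ∀ t, Function.Injective (A.kappa t)) : A.Containment ↔ A.Factors :=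
  ⟨fun h => ⟨A.factorisation hκ h, A.phiProd_comp_factorisation hκ h⟩, A.containment_of_factors⟩

/-- … and the factorisation is UNIQUE. [cite: LANA2026Report, §9.1 (f) p. 45] -/
theorem factorisation_unique (hκ : ∀ t, Function.Injective (A.kappa t)) (lam lam' : A.MFrob →* ∀ t, A.O t)
    (h : A.phiProd.comp lam = A.psi) (h' : A.phiProd.comp lam' = A.psi) : lam = lam' :=
  MonoidHom.ext fun m => A.phiProd_injective hκ (by
    rw [← MonoidHom.comp_apply, h, ← MonoidHom.comp_apply, h'])

/-- **Step 7, consequence (§6.2 (h))**: "The image of the Frobenioid-theoretic theta monoid `M^{Θ,Frob}_{v,∞}`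
coincides with the image of the Gaussian monoid under `φ_v`" — given a factorisation `λ`, the image of
`M^{Θ,Frob}` under `ψ_v` IS the image under `φ_v` of the submonoid `λ(M^{Θ,Frob}) ≤ ∏_t O^▷_{v,t}` (the typed
"may naturally be regarded as a submonoid of `∏_t O^▷_{v,t}`"). [cite: LANA2026Report, §6.2 (h) p. 36] -/
theorem mrange_psi_eq_map (lam : A.MFrob →* ∀ t, A.O t) (h : A.phiProd.comp lam = A.psi) :
    MonoidHom.mrange A.psi = (MonoidHom.mrange lam).map A.phiProd := by
  rw [← h, MonoidHom.mrange_eq_map, MonoidHom.mrange_eq_map, ← Submonoid.map_map]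

end EtaSteps

/-! ## 4. Non-vacuity of the signature -/

/-- The signature is inhabited (all groups trivial, one label): the hypotheses `Containment`/`Factors`
are satisfiable — a typing check, not mathematics. [folklore] -/
def EtaSteps.trivial : EtaSteps where
  H1Y := PUnit
  thetaClasses := ∅
  thetaInf := ⊥
  unitsEt := ⊥
  thetaClasses_subset := Set.empty_subset _
  MFrob := PUnit
  H1Yext := PUnit
  kum := 1
  rgd := MulEquiv.refl PUnit
  T := PUnit
  H1D _ := PUnit
  res _ := 1
  O _ := PUnit
  H1DΛ _ := PUnit
  kappa _ := 1
  sync _ := MulEquiv.refl PUnit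
  qPow _ := PUnit.unit

/-- In the trivial signature the containment holds (non-vacuity of the hypothesis). [folklore] -/
theorem EtaSteps.trivial_containment : EtaSteps.trivial.Containment := by
  rintro x -
  exact ⟨fun _ => PUnit.unit, funext fun _ => Subsingleton.elim (α := PUnit) _ _⟩

/-! ## 5. Appendix (after review of p404205): the Steps 2–3 ↔ Step 4 link, and a model where the containment fails -/

namespace EtaSteps

variable (A : EtaSteps)

/-- **p. 34, the "schematic shorthand" made explicit (HYPOTHESIS linking Steps 2–3 to Step 4)**: "In the
strict formulation, one distinguishes the Frobenioid-theoretic theta monoid `M^{Θ,Frob}_{v,∞}` … from its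
Kummer-theoretic image, which is the object actually described by the cohomological expression above. We use
the same notation `M^Θ_{v,∞}` for both sides only as a schematic shorthand." — the image of `M^{Θ,Frob}` under
`Θ-Λ-rgd ∘ Kummer` IS `O^×_v(Π_v) · ∞θ(Π_v)`. [cite: LANA2026Report, §6.2 (d) p. 34] -/
@[cite "LANA2026Report" "§6.2 (d) p. 34"]
def KummerImageEq : Prop := MonoidHom.mrange (A.rgd.toMonoidHom.comp A.kum) = A.thetaMonoidEt

/-- Under the link, every Kummer image of the Frobenioid-theoretic theta monoid lies in the étale-like theta
monoid `M^Θ_{v,∞}` (so `ψ_v` is "the map from (the Frobenius-like version of) the theta monoid").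
[cite: LANA2026Report, §6.2 (d) p. 34, §6.2 (g) p. 36] -/
theorem rgd_kum_mem_thetaMonoidEt (h : A.KummerImageEq) (m : A.MFrob) : A.rgd (A.kum m) ∈ A.thetaMonoidEt := by
  rw [KummerImageEq] at h
  rw [← h]
  exact ⟨m, rfl⟩

end EtaSteps

/-- A signature in which the containment FAILS (theta monoid `ℤ` mapping identically into `∞H¹ = ℤ`, but
`O^▷_{v,t}` trivial): the hypothesis `Containment` is NOT automatic — it is genuine content of Theorem 3.11
(ii) in LANA's reading (vacuity audit, other direction; the reviewer of p404205 asked for exactly this).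
[folklore] -/
def EtaSteps.obstructed : EtaSteps where
  H1Y := Multiplicative ℤ
  thetaClasses := ∅
  thetaInf := ⊥
  unitsEt := ⊥
  thetaClasses_subset := Set.empty_subset _
  MFrob := Multiplicative ℤ
  H1Yext := Multiplicative ℤ
  kum := MonoidHom.id _
  rgd := MulEquiv.refl _
  T := PUnit
  H1D _ := Multiplicative ℤ
  res _ := MonoidHom.id _
  O _ := PUnit
  H1DΛ _ := Multiplicative ℤ
  kappa _ := 1
  sync _ := MulEquiv.refl _
  qPow _ := PUnit.unit

/-- In `EtaSteps.obstructed` the containment fails: `ψ_v(1) = 1 ∈ ℤ` (written multiplicatively: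
`ofAdd 1`) is not in the image of `φ_v`, which is trivial. [folklore] -/
theorem EtaSteps.not_containment_obstructed : ¬ EtaSteps.obstructed.Containment := by
  intro h
  obtain ⟨a, ha⟩ := h ⟨Multiplicative.ofAdd (1 : ℤ), rfl⟩
  have h1 := congrFun ha PUnit.unit
  rw [EtaSteps.phiProd_apply, EtaSteps.phi_apply] at h1
  change (MulEquiv.refl (Multiplicative ℤ)).symm ((1 : PUnit →* Multiplicative ℤ) (a PUnit.unit)) =
    Multiplicative.ofAdd (1 : ℤ) at h1
  rw [MonoidHom.one_apply, MulEquiv.refl_symm, MulEquiv.refl_apply] at h1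
  exact absurd (congrArg Multiplicative.toAdd h1) (by decide)

end IUTFork

end Summit.ABC
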